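import Literature.Probability.LatticeModels.SampledSymbolDifferences
import Literature.Probability.LatticeModels.TorusFourierAnisotropicDecay
import Literature.Probability.LatticeModels.AnisotropicTorusSum
import HarnessLib

/-!
# Anisotropic decay and weighted `L¹` bound of the lattice Fourier sum of a sampled space-time symbol (Lemma 2.2 at finite `(β, L)`)

Topic `Literature/Probability/LatticeModels`; the assembly of `TorusFourierAnisotropicDecay.lean` (decay of a
product-torus character sum from directional difference bounds), `SampledSymbolDifferences.lean` (difference bounds of
a SAMPLED continuum symbol from derivative bounds along real lines) and `AnisotropicTorusSum.lean` (the lattice sum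
of the resulting anisotropic decay factor).  For a continuum symbol `Φ : ℝ × ℝ² → E` of class `Cᴺ`, sampled as
`G(i, k⃗) = Φ(a₀ + h₀ i, hₓ k̃)` on `(ℤ/Pℤ)¹ × (ℤ/Lℤ)²` (kept Matsubara frequencies × torus momenta), supported on `n`
points well inside the frequency window and the zone, bounded by `A`, and with `N`-th derivatives along the five
lines `(h₀,0)`, `(0,hₓe₁)`, `(0,hₓe₂)`, `(0,hₓv⊥)`, `(0,hₓv)` bounded by `K₀, K₁, K₂, K⊥, K∥` (`v` an integer vector,
`v⊥ = (-v₂, v₁)`), the character sum `g(z) = Σ_p χ_{p₁}(z₁)χ_{p₂}(z₂) • G(p)` obeys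

* **`norm_charSum_mul_decayFactor_pow_le`** (pointwise, Benfatto–Giuliani–Mastropietro 2006 (2.52) at finite `(β,L)`):
  `‖g(z)‖ (1 + s₀|z̃₁| + s₁(|z̃₂₁|+|z̃₂₂|) + s₂|ã_{v⊥}(z₂)| + s₃|ã_v(z₂)|)^N
     ≤ 6^N n (A + (N+1)((s₀P/4)^N K₀ + (s₁L/4)^N (K₁+K₂) + (s₂L/4)^N K⊥ + (s₃L/4)^N K∥))` for all rates `sᵢ ≥ 0`;
* **`sum_weight_mul_norm_charSum_le`** (weighted `L¹`, BGM (2.81) with the moment weights of §3 (3.2)):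
  `Σ_z (1 + cₜ|z̃₁| + cₓ(|z̃₂₁|+|z̃₂₂|))^{N_w} ‖g(z)‖ ≤ [the same constant] ·
     32(1/s₀+1)[8(2√2/(s₂|v|)+2)(2√2/(s₃|v|)+2) + (1+s₁R₀)^{-(N-N_w-6)} 32(1/s₁+1)²]`
  for `cₜ ≤ s₀`, `cₓ ≤ s₁`, `N_w + 6 ≤ N`, `2(|v₁|+|v₂|)R₀ < L`.

With the data of a sector at scale `h` (`n ≍ βL²γ^{5h/2}`, `A ≍ γ^{-h}/(βL²)`, `sᵢ` the dual rates, `Kᵢ ≍ A (4/(sᵢ·side))^N`)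
the first is `C_N γ^{3h/2}(1 + γ^h|x₀| + γ^h|x'₁| + γ^{h/2}|x'₂|)^{-N}` and the second `C γ^{-h}` (times the time weight).

Everything is proved; no definitions, no named facts. [folklore]

## Sources

G. Benfatto, A. Giuliani, V. Mastropietro, Ann. Henri Poincaré 7 (2006) 809–898, Lemma 2.2 (2.52), (2.81), §3 (3.2) and
footnote ¹ (`BenfattoGiulianiMastropietro2006`); G. Benfatto, V. Mastropietro, Rev. Math. Phys. 13 (2001) 1323–1435,
§2.3 (`BenfattoMastropietro2001`).
-/

noncomputable section

open Finset Complex Literature.Analysis.Calculus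
open scoped Real ComplexConjugate

namespace Literature.Probability.LatticeModels

variable {P L : ℕ} [NeZero P] [NeZero L] {E : Type*} [NormedAddCommGroup E] [NormedSpace ℂ E]

/-! ### The decay variables of the unit steps -/

omit [NeZero L] in
/-- For the axis `e₁ = (1, 0)`: the decay variable is `z̃₁`. [folklore] -/
theorem valMinAbs_sum_axis_fst (z : TorusSite 2 L) :
    (∑ j, (((![1, 0] : Fin 2 → ℤ) j : ℤ) : ZMod L) * z j).valMinAbs = (z 0).valMinAbs := by
  rw [Fin.sum_univ_two]; simp

omit [NeZero L] in
/-- For the axis `e₂ = (0, 1)`: the decay variable is `z̃₂`. [folklore] -/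
theorem valMinAbs_sum_axis_snd (z : TorusSite 2 L) :
    (∑ j, (((![0, 1] : Fin 2 → ℤ) j : ℤ) : ZMod L) * z j).valMinAbs = (z 1).valMinAbs := by
  rw [Fin.sum_univ_two]; simp

omit [NormedSpace ℂ E] in
/-- `Σ_p ‖G p‖ ≤ n · A` for a family bounded by `A ≥ 0` and vanishing off at most `n` points. [folklore] -/
theorem sum_norm_le_card_mul {ι : Type*} [Fintype ι] (G : ι → E) {A : ℝ} (hA0 : 0 ≤ A) (hA : ∀ p, ‖G p‖ ≤ A)
    [DecidablePred fun p : ι => G p ≠ 0] {n : ℝ} (hn : (((univ.filter fun p : ι => G p ≠ 0).card : ℕ) : ℝ) ≤ n) :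
    ∑ p, ‖G p‖ ≤ n * A := by
  calc ∑ p, ‖G p‖ = ∑ p ∈ univ.filter (fun p : ι => G p ≠ 0), ‖G p‖ := by
        rw [sum_filter_of_ne]; intro p _ h; exact fun h0 => h (by rw [h0, norm_zero])
    _ ≤ ∑ _p ∈ univ.filter (fun p : ι => G p ≠ 0), A := sum_le_sum fun p _ => hA p
    _ = ((univ.filter fun p : ι => G p ≠ 0).card : ℝ) * A := by rw [sum_const, nsmul_eq_mul]
    _ ≤ n * A := mul_le_mul_of_nonneg_right (by exact_mod_cast hn) hA0

/-! ### The pointwise decay bound -/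

/-- **Anisotropic decay of the lattice Fourier sum of a sampled symbol** (Benfatto–Giuliani–Mastropietro 2006,
Lemma 2.2 (2.52) at finite `(β, L)`): with the data described in the module docstring, for every `z` and all rates
`s₀, s₁, s₂, s₃ ≥ 0`,
`‖g(z)‖ (1 + s₀|z̃₁| + s₁(|z̃₂₁|+|z̃₂₂|) + s₂|ã_{v⊥}(z₂)| + s₃|ã_v(z₂)|)^N
   ≤ 6^N n (A + (N+1)((s₀P/4)^N K₀ + (s₁L/4)^N (K₁+K₂) + (s₂L/4)^N K⊥ + (s₃L/4)^N K∥))`.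
[cite: BenfattoGiulianiMastropietro2006, Lemma 2.2 (2.52) and footnote 1] -/
theorem norm_charSum_mul_decayFactor_pow_le (Φ : ℝ × (Fin 2 → ℝ) → E) (a₀ h₀ hx : ℝ) (N : ℕ) (hΦ : ContDiff ℝ N Φ)
    (G : TorusSite 1 P × TorusSite 2 L → E)
    (hG : ∀ p, G p = Φ (a₀ + h₀ * (((p.1 0).val : ℕ) : ℝ), fun j => hx * (((p.2 j).valMinAbs : ℤ) : ℝ)))
    (v : Fin 2 → ℤ)
    (hst : ∀ (m : ℤ) (k : Fin 2 → ℝ), (m < N ∨ (P : ℤ) ≤ m + N) → Φ (a₀ + h₀ * (m : ℝ), k) = 0)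
    (hss : ∀ (k₀ : ℝ) (m : Fin 2 → ℤ), (∃ j, (L : ℤ) ≤ 2 * |m j| + 2 * N * (|v 0| + |v 1| + 1)) →
      Φ (k₀, fun j => hx * (m j : ℝ)) = 0)
    {A : ℝ} (hA0 : 0 ≤ A) (hA : ∀ p, ‖G p‖ ≤ A)
    [DecidablePred fun p : TorusSite 1 P × TorusSite 2 L => G p ≠ 0]
    {n : ℝ} (hn : (((univ.filter fun p : TorusSite 1 P × TorusSite 2 L => G p ≠ 0).card : ℕ) : ℝ) ≤ n)
    {K₀ K₁ K₂ K₃ K₄ : ℝ}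
    (hK₀ : ∀ (q : ℝ × (Fin 2 → ℝ)) (s : ℝ), s ∈ Set.Icc (0 : ℝ) N →
      ‖iteratedDeriv N (fun s : ℝ => Φ (q + s • ((h₀, 0) : ℝ × (Fin 2 → ℝ)))) s‖ ≤ K₀)
    (hK₁ : ∀ (q : ℝ × (Fin 2 → ℝ)) (s : ℝ), s ∈ Set.Icc (0 : ℝ) N →
      ‖iteratedDeriv N (fun s : ℝ => Φ (q + s • (((0 : ℝ), fun j => hx * (((![1, 0] : Fin 2 → ℤ) j : ℤ) : ℝ)) : ℝ × (Fin 2 → ℝ)))) s‖ ≤ K₁)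
    (hK₂ : ∀ (q : ℝ × (Fin 2 → ℝ)) (s : ℝ), s ∈ Set.Icc (0 : ℝ) N →
      ‖iteratedDeriv N (fun s : ℝ => Φ (q + s • (((0 : ℝ), fun j => hx * (((![0, 1] : Fin 2 → ℤ) j : ℤ) : ℝ)) : ℝ × (Fin 2 → ℝ)))) s‖ ≤ K₂)
    (hK₃ : ∀ (q : ℝ × (Fin 2 → ℝ)) (s : ℝ), s ∈ Set.Icc (0 : ℝ) N →
      ‖iteratedDeriv N (fun s : ℝ => Φ (q + s • (((0 : ℝ), fun j => hx * (((![-v 1, v 0] : Fin 2 → ℤ) j : ℤ) : ℝ)) : ℝ × (Fin 2 → ℝ)))) s‖ ≤ K₃)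
    (hK₄ : ∀ (q : ℝ × (Fin 2 → ℝ)) (s : ℝ), s ∈ Set.Icc (0 : ℝ) N →
      ‖iteratedDeriv N (fun s : ℝ => Φ (q + s • (((0 : ℝ), fun j => hx * ((v j : ℤ) : ℝ)) : ℝ × (Fin 2 → ℝ)))) s‖ ≤ K₄)
    {s₀ s₁ s₂ s₃ : ℝ} (hs₀ : 0 ≤ s₀) (hs₁ : 0 ≤ s₁) (hs₂ : 0 ≤ s₂) (hs₃ : 0 ≤ s₃)
    (z : TorusSite 1 P × TorusSite 2 L) :
    ‖∑ p : TorusSite 1 P × TorusSite 2 L, (torusChar p.1 z.1 * torusChar p.2 z.2) • G p‖ *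
        (1 + s₀ * |(((z.1 0).valMinAbs : ℤ) : ℝ)| + s₁ * (|(((z.2 0).valMinAbs : ℤ) : ℝ)| + |(((z.2 1).valMinAbs : ℤ) : ℝ)|)
          + s₂ * |(((∑ j, ((![-v 1, v 0] j : ℤ) : ZMod L) * z.2 j).valMinAbs : ℤ) : ℝ)|
          + s₃ * |(((∑ j, ((v j : ℤ) : ZMod L) * z.2 j).valMinAbs : ℤ) : ℝ)|) ^ N ≤
      6 ^ N * (n * (A + ((N : ℝ) + 1) * ((s₀ * P / 4) ^ N * K₀ + (s₁ * L / 4) ^ N * (K₁ + K₂) +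
        (s₂ * L / 4) ^ N * K₃ + (s₃ * L / 4) ^ N * K₄))) := by
  classical
  have hP : (0 : ℝ) < P := Nat.cast_pos.2 (Nat.pos_of_ne_zero (NeZero.ne P))
  have hL : (0 : ℝ) < L := Nat.cast_pos.2 (Nat.pos_of_ne_zero (NeZero.ne L))
  -- the step families: one time step, four space steps
  let W : Fin 4 → Fin 2 → ℤ := ![![1, 0], ![0, 1], ![-v 1, v 0], v]
  have hW0 : W 0 = ![1, 0] := rfl
  have hW1 : W 1 = ![0, 1] := rfl
  have hW2 : W 2 = ![-v 1, v 0] := rfl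
  have hW3 : W 3 = v := rfl
  let c₂ : Fin 4 → ℝ := ![s₁ * L / 4, s₁ * L / 4, s₂ * L / 4, s₃ * L / 4]
  have hc0 : c₂ 0 = s₁ * L / 4 := rfl
  have hc1 : c₂ 1 = s₁ * L / 4 := rfl
  have hc2 : c₂ 2 = s₂ * L / 4 := rfl
  have hc3 : c₂ 3 = s₃ * L / 4 := rfl
  have hc₂ : ∀ i ∈ (univ : Finset (Fin 4)), 0 ≤ c₂ i := by
    intro i _
    fin_cases i
    · show 0 ≤ s₁ * L / 4; positivity
    · show 0 ≤ s₁ * L / 4; positivity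
    · show 0 ≤ s₂ * L / 4; positivity
    · show 0 ≤ s₃ * L / 4; positivity
  have hmain := norm_sum_prodChar_smul_mul_one_add_pow_le (univ : Finset (Fin 1)) (univ : Finset (Fin 4)) G z.1 z.2 N
    (fun _ : Fin 1 => (fun _ : Fin 1 => (1 : ZMod P))) (fun i : Fin 4 => fun j => ((W i j : ℤ) : ZMod L))
    (fun _ => s₀ * P / 4) c₂ (fun _ _ => by positivity) hc₂
  rw [Fin.sum_univ_four, Fin.sum_univ_four, Fin.sum_univ_one, Fin.sum_univ_one, Fin.sum_univ_one] at hmain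
  simp only [one_mul, hW0, hW1, hW2, hW3, hc0, hc1, hc2, hc3] at hmain
  rw [valMinAbs_sum_axis_fst, valMinAbs_sum_axis_snd] at hmain
  -- identify the decay factor
  have hlhs : 1 + s₀ * P / 4 * (4 * |(((z.1 0).valMinAbs : ℤ) : ℝ)| / P) +
      (s₁ * L / 4 * (4 * |(((z.2 0).valMinAbs : ℤ) : ℝ)| / L) + s₁ * L / 4 * (4 * |(((z.2 1).valMinAbs : ℤ) : ℝ)| / L) +
        s₂ * L / 4 * (4 * |(((∑ j, (((![-v 1, v 0] : Fin 2 → ℤ) j : ℤ) : ZMod L) * z.2 j).valMinAbs : ℤ) : ℝ)| / L) +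
        s₃ * L / 4 * (4 * |(((∑ j, ((v j : ℤ) : ZMod L) * z.2 j).valMinAbs : ℤ) : ℝ)| / L)) =
      1 + s₀ * |(((z.1 0).valMinAbs : ℤ) : ℝ)| + s₁ * (|(((z.2 0).valMinAbs : ℤ) : ℝ)| + |(((z.2 1).valMinAbs : ℤ) : ℝ)|)
          + s₂ * |(((∑ j, ((![-v 1, v 0] j : ℤ) : ZMod L) * z.2 j).valMinAbs : ℤ) : ℝ)|
          + s₃ * |(((∑ j, ((v j : ℤ) : ZMod L) * z.2 j).valMinAbs : ℤ) : ℝ)| := by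
    field_simp
    ring
  rw [hlhs] at hmain
  refine hmain.trans ?_
  -- the constants: `|I₁| = 1`, `|I₂| = 4`
  have hcard : (((univ : Finset (Fin 1)).card : ℕ) : ℝ) + ((univ : Finset (Fin 4)).card : ℕ) + 1 = 6 := by
    simp; norm_num
  rw [hcard]
  refine mul_le_mul_of_nonneg_left ?_ (by positivity)
  -- the space-seam hypothesis for each of the four steps
  have hWss : ∀ (u : Fin 2 → ℤ), (∀ j, |u j| ≤ |v 0| + |v 1| + 1) → ∀ (k₀ : ℝ) (m : Fin 2 → ℤ),
      (∃ j, (L : ℤ) ≤ 2 * |m j| + 2 * N * |u j|) → Φ (k₀, fun j => hx * (m j : ℝ)) = 0 := by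
    intro u hu k₀ m hm
    obtain ⟨j, hj⟩ := hm
    refine hss k₀ m ⟨j, hj.trans ?_⟩
    have hN : (0 : ℤ) ≤ 2 * N := by positivity
    nlinarith [hu j, abs_nonneg (u j)]
  have hv0 := abs_nonneg (v 0)
  have hv1 := abs_nonneg (v 1)
  have hu₁ : ∀ j, |(![1, 0] : Fin 2 → ℤ) j| ≤ |v 0| + |v 1| + 1 := by
    intro j; fin_cases j
    · show |(1 : ℤ)| ≤ _; rw [abs_one]; linarith
    · show |(0 : ℤ)| ≤ _; rw [abs_zero]; linarith
  have hu₂ : ∀ j, |(![0, 1] : Fin 2 → ℤ) j| ≤ |v 0| + |v 1| + 1 := by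
    intro j; fin_cases j
    · show |(0 : ℤ)| ≤ _; rw [abs_zero]; linarith
    · show |(1 : ℤ)| ≤ _; rw [abs_one]; linarith
  have hu₃ : ∀ j, |(![-v 1, v 0] : Fin 2 → ℤ) j| ≤ |v 0| + |v 1| + 1 := by
    intro j; fin_cases j
    · show |-v 1| ≤ _; rw [abs_neg]; linarith
    · show |v 0| ≤ _; linarith
  have hu₄ : ∀ j, |v j| ≤ |v 0| + |v 1| + 1 := by
    intro j; fin_cases j
    · show |v 0| ≤ _; linarith
    · show |v 1| ≤ _; linarith
  -- the five difference bounds and the trivial bound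
  have hD₀ := sum_norm_fwdDiff_iter_time_le (P := P) (L := L) Φ a₀ h₀ hx N hΦ G hG hst hK₀
  have hD₁ := sum_norm_fwdDiff_iter_space_le (P := P) (L := L) Φ a₀ h₀ hx N hΦ G hG _ (hWss _ hu₁) hK₁
  have hD₂ := sum_norm_fwdDiff_iter_space_le (P := P) (L := L) Φ a₀ h₀ hx N hΦ G hG _ (hWss _ hu₂) hK₂
  have hD₃ := sum_norm_fwdDiff_iter_space_le (P := P) (L := L) Φ a₀ h₀ hx N hΦ G hG _ (hWss _ hu₃) hK₃
  have hD₄ := sum_norm_fwdDiff_iter_space_le (P := P) (L := L) Φ a₀ h₀ hx N hΦ G hG v (hWss _ hu₄) hK₄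
  have hT := sum_norm_le_card_mul G hA0 hA hn
  -- nonnegativity of the difference constants (each bounds a norm)
  have hK₀0 : 0 ≤ K₀ := (norm_nonneg _).trans (hK₀ 0 0 ⟨le_rfl, Nat.cast_nonneg N⟩)
  have hK₁0 : 0 ≤ K₁ := (norm_nonneg _).trans (hK₁ 0 0 ⟨le_rfl, Nat.cast_nonneg N⟩)
  have hK₂0 : 0 ≤ K₂ := (norm_nonneg _).trans (hK₂ 0 0 ⟨le_rfl, Nat.cast_nonneg N⟩)
  have hK₃0 : 0 ≤ K₃ := (norm_nonneg _).trans (hK₃ 0 0 ⟨le_rfl, Nat.cast_nonneg N⟩)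
  have hK₄0 : 0 ≤ K₄ := (norm_nonneg _).trans (hK₄ 0 0 ⟨le_rfl, Nat.cast_nonneg N⟩)
  have hcnt0 : (0 : ℝ) ≤ (((univ.filter fun p : TorusSite 1 P × TorusSite 2 L => G p ≠ 0).card : ℕ) : ℝ) :=
    Nat.cast_nonneg _
  have hN1 : (0 : ℝ) ≤ (N : ℝ) + 1 := by positivity
  -- `c · Σ ≤ c · ((N+1) n K)` for each direction
  have hup : ∀ {c S K : ℝ}, 0 ≤ c → 0 ≤ K →
      S ≤ ((N : ℝ) + 1) * ((((univ.filter fun p : TorusSite 1 P × TorusSite 2 L => G p ≠ 0).card : ℕ) : ℝ)) * K →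
      c * S ≤ c * (((N : ℝ) + 1) * n * K) := by
    intro c S K hc hK h
    refine mul_le_mul_of_nonneg_left (h.trans ?_) hc
    exact mul_le_mul_of_nonneg_right (mul_le_mul_of_nonneg_left hn hN1) hK
  have e₀ := hup (c := (s₀ * P / 4) ^ N) (by positivity) hK₀0 hD₀
  have e₁ := hup (c := (s₁ * L / 4) ^ N) (by positivity) hK₁0 hD₁
  have e₂ := hup (c := (s₁ * L / 4) ^ N) (by positivity) hK₂0 hD₂
  have e₃ := hup (c := (s₂ * L / 4) ^ N) (by positivity) hK₃0 hD₃
  have e₄ := hup (c := (s₃ * L / 4) ^ N) (by positivity) hK₄0 hD₄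
  refine (add_le_add (add_le_add hT e₀) (add_le_add (add_le_add (add_le_add e₁ e₂) e₃) e₄)).trans (le_of_eq ?_)
  ring

/-! ### The weighted `L¹` bound -/

/-- Elementary: if `a D^N ≤ C` with `D ≥ 1`, `a ≥ 0`, and `W ≤ D^{N_w}` with `N_w ≤ N`, then
`W a ≤ C · D^{-(N - N_w)}`. [folklore] -/
theorem weight_mul_le_of_mul_pow_le {a C D W : ℝ} {N Nw : ℕ} (ha : 0 ≤ a) (hD : 1 ≤ D) (h : a * D ^ N ≤ C)
    (hW : W ≤ D ^ Nw) (hNw : Nw ≤ N) : W * a ≤ C * D⁻¹ ^ (N - Nw) := by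
  have hD0 : 0 < D := by linarith
  have hC : a ≤ C * D⁻¹ ^ N := by
    rw [inv_pow, ← div_eq_mul_inv, le_div_iff₀ (pow_pos hD0 N)]
    exact h
  have hC0 : 0 ≤ C := le_trans (by positivity) h
  calc W * a ≤ D ^ Nw * (C * D⁻¹ ^ N) := mul_le_mul hW hC ha (by positivity)
    _ = C * (D ^ Nw * D⁻¹ ^ Nw) * D⁻¹ ^ (N - Nw) := by
        rw [show N = Nw + (N - Nw) from (Nat.add_sub_cancel' hNw).symm, pow_add, Nat.add_sub_cancel_left]
        ring
    _ = C * D⁻¹ ^ (N - Nw) := by rw [← mul_pow, mul_inv_cancel₀ hD0.ne', one_pow, mul_one]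

/-- **Weighted `L¹` bound of the lattice Fourier sum of a sampled symbol** (Benfatto–Giuliani–Mastropietro 2006, (2.81)
with the moment weights of §3 (3.2), at finite `(β, L)`): with the data of `norm_charSum_mul_decayFactor_pow_le`, rates
`sᵢ > 0`, `v ≠ 0`, a near radius `R₀` with `2(|v₁|+|v₂|)R₀ < L`, a weight exponent `N_w + 6 ≤ N` and weight rates
`0 ≤ cₜ ≤ s₀`, `0 ≤ cₓ ≤ s₁`:
`Σ_z (1 + cₜ|z̃₁| + cₓ(|z̃₂₁|+|z̃₂₂|))^{N_w} ‖g(z)‖ ≤ 6^N n (A + (N+1)(…)) · 32(1/s₀+1)[8(2√2/(s₂|v|)+2)(2√2/(s₃|v|)+2)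
+ (1+s₁R₀)^{-(N-N_w-6)} 32(1/s₁+1)²]`. [cite: BenfattoGiulianiMastropietro2006, §2.6 (2.81) and §3 (3.2)] -/
theorem sum_weight_mul_norm_charSum_le (Φ : ℝ × (Fin 2 → ℝ) → E) (a₀ h₀ hx : ℝ) (N : ℕ) (hΦ : ContDiff ℝ N Φ)
    (G : TorusSite 1 P × TorusSite 2 L → E)
    (hG : ∀ p, G p = Φ (a₀ + h₀ * (((p.1 0).val : ℕ) : ℝ), fun j => hx * (((p.2 j).valMinAbs : ℤ) : ℝ)))
    (v : Fin 2 → ℤ) (hv : v ≠ 0)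
    (hst : ∀ (m : ℤ) (k : Fin 2 → ℝ), (m < N ∨ (P : ℤ) ≤ m + N) → Φ (a₀ + h₀ * (m : ℝ), k) = 0)
    (hss : ∀ (k₀ : ℝ) (m : Fin 2 → ℤ), (∃ j, (L : ℤ) ≤ 2 * |m j| + 2 * N * (|v 0| + |v 1| + 1)) →
      Φ (k₀, fun j => hx * (m j : ℝ)) = 0)
    {A : ℝ} (hA0 : 0 ≤ A) (hA : ∀ p, ‖G p‖ ≤ A)
    [DecidablePred fun p : TorusSite 1 P × TorusSite 2 L => G p ≠ 0]
    {n : ℝ} (hn : (((univ.filter fun p : TorusSite 1 P × TorusSite 2 L => G p ≠ 0).card : ℕ) : ℝ) ≤ n)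
    {K₀ K₁ K₂ K₃ K₄ : ℝ}
    (hK₀ : ∀ (q : ℝ × (Fin 2 → ℝ)) (s : ℝ), s ∈ Set.Icc (0 : ℝ) N →
      ‖iteratedDeriv N (fun s : ℝ => Φ (q + s • ((h₀, 0) : ℝ × (Fin 2 → ℝ)))) s‖ ≤ K₀)
    (hK₁ : ∀ (q : ℝ × (Fin 2 → ℝ)) (s : ℝ), s ∈ Set.Icc (0 : ℝ) N →
      ‖iteratedDeriv N (fun s : ℝ => Φ (q + s • (((0 : ℝ), fun j => hx * (((![1, 0] : Fin 2 → ℤ) j : ℤ) : ℝ)) : ℝ × (Fin 2 → ℝ)))) s‖ ≤ K₁)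
    (hK₂ : ∀ (q : ℝ × (Fin 2 → ℝ)) (s : ℝ), s ∈ Set.Icc (0 : ℝ) N →
      ‖iteratedDeriv N (fun s : ℝ => Φ (q + s • (((0 : ℝ), fun j => hx * (((![0, 1] : Fin 2 → ℤ) j : ℤ) : ℝ)) : ℝ × (Fin 2 → ℝ)))) s‖ ≤ K₂)
    (hK₃ : ∀ (q : ℝ × (Fin 2 → ℝ)) (s : ℝ), s ∈ Set.Icc (0 : ℝ) N →
      ‖iteratedDeriv N (fun s : ℝ => Φ (q + s • (((0 : ℝ), fun j => hx * (((![-v 1, v 0] : Fin 2 → ℤ) j : ℤ) : ℝ)) : ℝ × (Fin 2 → ℝ)))) s‖ ≤ K₃)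
    (hK₄ : ∀ (q : ℝ × (Fin 2 → ℝ)) (s : ℝ), s ∈ Set.Icc (0 : ℝ) N →
      ‖iteratedDeriv N (fun s : ℝ => Φ (q + s • (((0 : ℝ), fun j => hx * ((v j : ℤ) : ℝ)) : ℝ × (Fin 2 → ℝ)))) s‖ ≤ K₄)
    {s₀ s₁ s₂ s₃ : ℝ} (hs₀ : 0 < s₀) (hs₁ : 0 < s₁) (hs₂ : 0 < s₂) (hs₃ : 0 < s₃)
    {R₀ : ℕ} (hR₀ : 2 * (|v 0| + |v 1|) * (R₀ : ℤ) < L) {Nw : ℕ} (hNw : Nw + 6 ≤ N)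
    {ct cx : ℝ} (hct0 : 0 ≤ ct) (hct : ct ≤ s₀) (hcx0 : 0 ≤ cx) (hcx : cx ≤ s₁) :
    ∑ z : TorusSite 1 P × TorusSite 2 L,
      (1 + ct * |(((z.1 0).valMinAbs : ℤ) : ℝ)| + cx * (|(((z.2 0).valMinAbs : ℤ) : ℝ)| + |(((z.2 1).valMinAbs : ℤ) : ℝ)|)) ^ Nw *
        ‖∑ p : TorusSite 1 P × TorusSite 2 L, (torusChar p.1 z.1 * torusChar p.2 z.2) • G p‖ ≤
      6 ^ N * (n * (A + ((N : ℝ) + 1) * ((s₀ * P / 4) ^ N * K₀ + (s₁ * L / 4) ^ N * (K₁ + K₂) +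
        (s₂ * L / 4) ^ N * K₃ + (s₃ * L / 4) ^ N * K₄))) *
      (32 * (1 / s₀ + 1) *
        (8 * ((2 * Real.sqrt 2 / (s₂ * Real.sqrt ((v 0 : ℝ) ^ 2 + (v 1 : ℝ) ^ 2)) + 2) *
            (2 * Real.sqrt 2 / (s₃ * Real.sqrt ((v 0 : ℝ) ^ 2 + (v 1 : ℝ) ^ 2)) + 2))
          + (1 + s₁ * R₀)⁻¹ ^ (N - Nw - 6) * (32 * (1 / s₁ + 1) ^ 2))) := by
  -- the decay factor at each point, and the pointwise consequence of the decay bound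
  set C : ℝ := 6 ^ N * (n * (A + ((N : ℝ) + 1) * ((s₀ * P / 4) ^ N * K₀ + (s₁ * L / 4) ^ N * (K₁ + K₂) +
        (s₂ * L / 4) ^ N * K₃ + (s₃ * L / 4) ^ N * K₄))) with hC
  have hpt : ∀ z : TorusSite 1 P × TorusSite 2 L,
      (1 + ct * |(((z.1 0).valMinAbs : ℤ) : ℝ)| + cx * (|(((z.2 0).valMinAbs : ℤ) : ℝ)| + |(((z.2 1).valMinAbs : ℤ) : ℝ)|)) ^ Nw *
        ‖∑ p : TorusSite 1 P × TorusSite 2 L, (torusChar p.1 z.1 * torusChar p.2 z.2) • G p‖ ≤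
      C * (1 + s₀ * |(((z.1 0).valMinAbs : ℤ) : ℝ)| + s₁ * (|(((z.2 0).valMinAbs : ℤ) : ℝ)| + |(((z.2 1).valMinAbs : ℤ) : ℝ)|)
          + s₂ * |(((∑ j, ((![-v 1, v 0] j : ℤ) : ZMod L) * z.2 j).valMinAbs : ℤ) : ℝ)|
          + s₃ * |(((∑ j, ((v j : ℤ) : ZMod L) * z.2 j).valMinAbs : ℤ) : ℝ)|)⁻¹ ^ (N - Nw) := by
    intro z
    have h := norm_charSum_mul_decayFactor_pow_le Φ a₀ h₀ hx N hΦ G hG v hst hss hA0 hA hn hK₀ hK₁ hK₂ hK₃ hK₄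
      hs₀.le hs₁.le hs₂.le hs₃.le z
    have ht : 0 ≤ |(((z.1 0).valMinAbs : ℤ) : ℝ)| := abs_nonneg _
    have hx0 : 0 ≤ |(((z.2 0).valMinAbs : ℤ) : ℝ)| := abs_nonneg _
    have hx1 : 0 ≤ |(((z.2 1).valMinAbs : ℤ) : ℝ)| := abs_nonneg _
    have hb2 : 0 ≤ s₂ * |(((∑ j, ((![-v 1, v 0] j : ℤ) : ZMod L) * z.2 j).valMinAbs : ℤ) : ℝ)| := by positivity
    have hb3 : 0 ≤ s₃ * |(((∑ j, ((v j : ℤ) : ZMod L) * z.2 j).valMinAbs : ℤ) : ℝ)| := by positivity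
    refine weight_mul_le_of_mul_pow_le (norm_nonneg _) ?_ h ?_ (by omega)
    · nlinarith [mul_nonneg hs₀.le ht, mul_nonneg hs₁.le (add_nonneg hx0 hx1)]
    · refine pow_le_pow_left₀ (by positivity) ?_ Nw
      nlinarith [mul_le_mul_of_nonneg_right hct ht, mul_le_mul_of_nonneg_right hcx (add_nonneg hx0 hx1)]
  have hsum := sum_inv_pow_spaceTimeTorus_le (P := P) (L := L) v hv hs₀ hs₁ hs₂ hs₃ hR₀ (m := N - Nw) (by omega)
  have hC0 : 0 ≤ C := by
    have h := norm_charSum_mul_decayFactor_pow_le Φ a₀ h₀ hx N hΦ G hG v hst hss hA0 hA hn hK₀ hK₁ hK₂ hK₃ hK₄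
      hs₀.le hs₁.le hs₂.le hs₃.le 0
    exact le_trans (by positivity) h
  calc ∑ z : TorusSite 1 P × TorusSite 2 L, _ ≤ ∑ z : TorusSite 1 P × TorusSite 2 L,
        C * (1 + s₀ * |(((z.1 0).valMinAbs : ℤ) : ℝ)| + s₁ * (|(((z.2 0).valMinAbs : ℤ) : ℝ)| + |(((z.2 1).valMinAbs : ℤ) : ℝ)|)
          + s₂ * |(((∑ j, ((![-v 1, v 0] j : ℤ) : ZMod L) * z.2 j).valMinAbs : ℤ) : ℝ)|
          + s₃ * |(((∑ j, ((v j : ℤ) : ZMod L) * z.2 j).valMinAbs : ℤ) : ℝ)|)⁻¹ ^ (N - Nw) := sum_le_sum fun z _ => hpt z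
    _ = C * ∑ z : TorusSite 1 P × TorusSite 2 L,
        (1 + s₀ * |(((z.1 0).valMinAbs : ℤ) : ℝ)| + s₁ * (|(((z.2 0).valMinAbs : ℤ) : ℝ)| + |(((z.2 1).valMinAbs : ℤ) : ℝ)|)
          + s₂ * |(((∑ j, ((![-v 1, v 0] j : ℤ) : ZMod L) * z.2 j).valMinAbs : ℤ) : ℝ)|
          + s₃ * |(((∑ j, ((v j : ℤ) : ZMod L) * z.2 j).valMinAbs : ℤ) : ℝ)|)⁻¹ ^ (N - Nw) := by rw [mul_sum]
    _ ≤ C * (32 * (1 / s₀ + 1) *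
        (8 * ((2 * Real.sqrt 2 / (s₂ * Real.sqrt ((v 0 : ℝ) ^ 2 + (v 1 : ℝ) ^ 2)) + 2) *
            (2 * Real.sqrt 2 / (s₃ * Real.sqrt ((v 0 : ℝ) ^ 2 + (v 1 : ℝ) ^ 2)) + 2))
          + (1 + s₁ * R₀)⁻¹ ^ (N - Nw - 6) * (32 * (1 / s₁ + 1) ^ 2))) := mul_le_mul_of_nonneg_left hsum hC0


end Literature.Probability.LatticeModels
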